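import Summits.ResolutionOfSingularities.ResolutionOfSingularities.Theorems.HilbertSamuelEliminationCampaignW42ToricMarkedResidual

/-!
# [OURS · L1 W4.2] Toric marked monomial objects in dimension 3 — brick 6A: the PHASE INVARIANT and the ASSEMBLY modulo the phase lemma

[OURS · L1 W4.2 · seat res-L1-s42-pv-2 gen 5] Memo `L/res-L1-s42-pv-2/CALIBRATION-W42-O2-v4.md` §3/§5.  The outer induction of the existence proof
of toric order reduction (hence of `IdeasL1Idea2R8.InitialCornerSolvable` up to the bridges of memo §4): `PhaseInv m θs s` (well-formed,
non-negative, every unresolved corner has residual order `≤ θs`), its preservation under blow-ups of faces of full residual order (F1 global form),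
the admissibility of point moves at `θs`-corners, the named statement `PhaseLemma` («from the phase invariant at a positive level, legal blow-ups reach
a state whose unresolved corners all have residual order `< θs`» — to be proved in brick 5B by the potential `Λ` of brick 5A), and the ASSEMBLY:
`PhaseLemma ⇒ every well-formed non-negative state is E-resolvable` by induction on the level, with the monomial case (`eresolvable_of_principal`,
brick 2) as the base.  NOT a statement of the manuscript under review nor of Blanco / Encinas–Villamayor.  AI work, weaker than expert review.
No `sorry`, no new axiom; `PhaseLemma` is a `def … : Prop` taken as an explicit hypothesis (OURS, not a literature fact).
-/

set_option linter.dupNamespace false -- mandated namespace of this single-conjunct summit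

namespace Summit.ResolutionOfSingularities.ResolutionOfSingularities.Theorems.CampaignW42.Toric

namespace TState

open Finset

variable {ι : Type} [Fintype ι] [Nonempty ι]

/-- **[OURS · L1 W4.2]** The PHASE INVARIANT at residual level `θs`: well-formed, non-negative, and every unresolved corner has residual
order `≤ θs`. -/
def PhaseInv (m : ℕ) (θs : ℤ) (s : TState ι) : Prop :=
  s.WF ∧ s.Nonneg ∧ ∀ C ∈ s.cones, ¬ s.Resolved m C → s.thetaR C ≤ θs

/-- **(F1, global form)** A legal blow-up at a face of full residual order `θs` preserves the phase invariant. -/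
theorem PhaseInv.move {m : ℕ} {θs : ℤ} {s : TState ι} (h : s.PhaseInv m θs) {R : Finset ℕ} (hR : s.thetaR R = θs)
    (hlegal : s.Legal m R) : (s.move m R).PhaseInv m θs := by
  obtain ⟨hwf, hnn, hθ⟩ := h
  refine ⟨hwf.move R, hnn.move hlegal, fun D hD hnD => ?_⟩
  rw [mem_move_cones] at hD
  obtain ⟨C, hC, hDC⟩ := hD
  have hnC : s.next ∉ C := hwf.next_notMem hC
  by_cases hRC : R ⊆ C
  · rw [children_of_subset hRC, Finset.mem_image] at hDC
    obtain ⟨x, hx, rfl⟩ := hDC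
    have hnr : ¬ s.Resolved m C := not_resolved_of_legal_subset hnn hlegal hRC
    have h1 := hθ C hC hnr
    have h2 : s.thetaR C ≤ s.thetaR R := by rw [hR]; exact h1
    exact (thetaR_child_le hRC h2 (hRC hx) hnC).trans h1
  · rw [children_of_not_subset hRC, Finset.mem_singleton] at hDC
    subst hDC
    rw [thetaR_move_of_not_mem hnC]
    exact hθ D hC (fun hr => hnD ((resolved_move_iff_of_not_mem hnC).mpr hr))

/-- In a phase, a corner containing a face of full residual order is an unresolved `θs`-corner as soon as it is unresolved... precisely:
its residual order equals `θs`. -/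
theorem thetaR_eq_of_subset {m : ℕ} {θs : ℤ} {s : TState ι} (h : s.PhaseInv m θs) {R C : Finset ℕ} (hC : C ∈ s.cones)
    (hRC : R ⊆ C) (hR : s.thetaR R = θs) (hlegal : s.Legal m R) : s.thetaR C = θs := by
  have hnr : ¬ s.Resolved m C := not_resolved_of_legal_subset h.2.1 hlegal hRC
  exact le_antisymm (h.2.2 C hC hnr) (hR ▸ s.thetaR_mono hRC)

/-- A point move (the corner itself) is admissible at an unresolved `θs`-corner. -/
theorem admissible_self {m : ℕ} {θs : ℤ} {s : TState ι} {C : Finset ℕ} (hC : C ∈ s.cones) (hne : C.Nonempty)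
    (hθ : s.thetaR C = θs) (hnr : ¬ s.Resolved m C) : s.Admissible m θs C := by
  refine ⟨⟨hne, C, hC, subset_refl C⟩, hθ, fun _ => ?_⟩
  -- unresolved: every generator has Σ a ≥ m; at the residual minimiser Σ a = Σ β + θ_C
  obtain ⟨v, hv⟩ := s.exists_thetaR_eq C
  have h1 : ¬ s.faceSum C v < m := fun hlt => hnr ⟨v, hlt⟩
  have h2 := s.alphaSum_eq C v
  omega


omit [Fintype ι] [Nonempty ι] in
/-- `EResolvable` is closed under prefixing a play. -/
theorem EResolvable.of_play {m : ℕ} {s t : TState ι} (hp : s.Play m t) (ht : t.EResolvable m) : s.EResolvable m := by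
  obtain ⟨u, hu, hE⟩ := ht
  exact ⟨u, hp.trans hu, hE⟩

/-- **[OURS · L1 W4.2]** THE PHASE LEMMA as a statement: from a state satisfying the phase invariant at a positive residual level `θs`,
legal blow-ups lead to a state (still in the phase) all of whose unresolved corners have residual order `< θs`.  (Proved in brick 5B/6 by the
`Λ`-potential; here it is the named hypothesis of the assembly.) -/
def PhaseLemma (ι : Type) [Fintype ι] [Nonempty ι] (m : ℕ) : Prop :=
  ∀ (θs : ℤ) (s : TState ι), 0 < θs → s.PhaseInv m θs →
    ∃ t, s.Play m t ∧ t.PhaseInv m θs ∧ ∀ C ∈ t.cones, ¬ t.Resolved m C → t.thetaR C < θs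

/-- At residual level `0` the phase invariant says: every unresolved corner is principal. -/
theorem principal_of_phaseInv_zero {m : ℕ} {s : TState ι} (h : s.PhaseInv m 0) :
    ∀ C ∈ s.cones, ¬ s.Resolved m C → s.Principal C := by
  intro C hC hnr
  rw [← thetaR_eq_zero_iff_principal]
  exact le_antisymm (h.2.2 C hC hnr) (s.thetaR_nonneg C)

/-- **[OURS · L1 W4.2] ASSEMBLY (outer induction on the residual level).**  The phase lemma implies: every state satisfying the phase
invariant at some level is E-resolvable.  Base: level `0` is the monomial case (`eresolvable_of_principal`). -/
theorem eresolvable_of_phaseLemma {m : ℕ} (hm : 0 < m) (H : PhaseLemma ι m) :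
    ∀ (n : ℕ) (s : TState ι), s.PhaseInv m n → s.EResolvable m := by
  intro n
  induction n with
  | zero =>
    intro s h
    exact eresolvable_of_principal hm s h.1 h.2.1 (principal_of_phaseInv_zero (by simpa using h))
  | succ n ih =>
    intro s h
    have hpos : (0 : ℤ) < (n + 1 : ℕ) := by exact_mod_cast Nat.succ_pos n
    obtain ⟨t, hplay, ht, hlt⟩ := H _ s hpos h
    refine EResolvable.of_play hplay (ih t ⟨ht.1, ht.2.1, fun C hC hnr => ?_⟩)
    have := hlt C hC hnr
    push_cast at this ⊢
    omega

/-- Every well-formed non-negative state satisfies the phase invariant at the level of its largest residual order. -/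
theorem phaseInv_sup {m : ℕ} {s : TState ι} (hwf : s.WF) (hnn : s.Nonneg) :
    s.PhaseInv m ((s.cones.sup (fun C => (s.thetaR C).toNat) : ℕ) : ℤ) := by
  refine ⟨hwf, hnn, fun C hC _ => ?_⟩
  have h1 : (s.thetaR C).toNat ≤ s.cones.sup (fun C => (s.thetaR C).toNat) :=
    Finset.le_sup (f := fun C => (s.thetaR C).toNat) hC
  have h2 := s.thetaR_nonneg C
  have h3 : ((s.thetaR C).toNat : ℤ) = s.thetaR C := Int.toNat_of_nonneg h2
  omega

/-- **[OURS · L1 W4.2] MAIN THEOREM MODULO THE PHASE LEMMA.**  If the phase lemma holds, every well-formed state with non-negative exponents —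
in particular the initial corner of every W-top position — is E-resolvable by legal blow-ups (toric order reduction of the marked monomial
ideal in dimension 3). -/
theorem eresolvable_of_phaseLemma' {m : ℕ} (hm : 0 < m) (H : PhaseLemma ι m) (s : TState ι) (hwf : s.WF) (hnn : s.Nonneg) :
    s.EResolvable m :=
  eresolvable_of_phaseLemma hm H _ s (phaseInv_sup hwf hnn)

end TState

end Summit.ResolutionOfSingularities.ResolutionOfSingularities.Theorems.CampaignW42.Toric
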